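import Literature.MathematicalPhysics.QuantumFieldTheory.Balaban1983to89.B16StepFactorsPrinted

/-!
# `Balaban1983to89.B16StepFactorsRounding` — [Balaban1989LargeFieldII] p. 383 after (1.78): the rounding «we estimate the factors
by exp(−p₀(g_j))» WITH THE LETTER `A₀`, i.e. the hypothesis `hround` of `B16StepFactorsPrinted.stepFactor179_le` DISCHARGED in the
tree's `Setup.p0Profile` currency (companion leaf of INTERFACE REQUEST NE7b IR-100-2, p344269; X-read chair leaf-01 g64's note N-1:
`B16Sect1Kernels.exp_lfFactor_le_exp_neg_p0` reads `p₀(g) = ℓ^{p₀}`, the normalisation `A₀ = 1`, while `Setup.p0Profile` carries `A₀`;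
typist = gaps seat ne6 gen 3); and (§2) the VOLUME SIDE of (Y) in ONE exponential with the per-site letter `cΛ := C380 + C′`
(the owner's Q-J3-1 answered in kind; supplier of J4's `hvol` up to the consumer's cube count)

statement-level skeleton of published theorems with citation tags; proofs where landed; nothing here is a claim about
the Yang–Mills mass gap

HONEST FRAMING.  Six [cite]-tagged theorems of REAL ARITHMETIC between printed letters (the exponent proviso, (2.5)'s bracket; the volume
sentences); nothing of
Bałaban's is asserted, valued or discharged (the manuscript is UNDER AUDIT; 0∕13 main theorems proved in the tree).  Printed context,
verbatim (render `b2b-balaban-ref1/pages/1989-cmp122-large-field-II/…-p029-x2.png` = p. 383, READ AS AN IMAGE): *"… yield the following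
large field factor: exp(−½γ₀[6(d + 3)(100M(L + 1)N^{β₀}R_j)^{d+2}]⁻¹A₁²p₁(g_j)) < exp(−R_j^{−d−5}p₁²(g_j)). This is the largest factor
among all the small factors we have obtained from the large field characteristic functions in the preparatory steps. We assume that
2p₁ − (d + 5)r₀ > p₀, and we estimate the factors by exp(−p₀(g_j))."*; dictionary [Balaban1988Convergent] (2.4) p. 255 «ε_j =
g_jA₀(log g_j⁻²)^{p₀} = g_jp₀(g_j)», (2.5) «R_j is the smallest number of the form L^r such, that R_j ≧ (log g_j⁻²)^r»;
[Balaban1989LargeFieldI] p. 183 l. 1 «p₁(g_j) = (log g_j⁻²)^{p₁}».  Rung (B)+1 context only: NOT the continuum limit, NOT infinite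
volume, NOT a mass gap, NOT Clay.  BY-NAME EFFECT ON THE ROW's WALL: NONE; NE7b NOT PRINTED ∕ NOT PROVED; spine 0∕9.
-/

namespace Literature.MathematicalPhysics.QuantumFieldTheory.Balaban1983to89.B16StepFactorsRounding

open Literature.MathematicalPhysics.QuantumFieldTheory.Balaban1983to89
open Literature.MathematicalPhysics.QuantumFieldTheory.Balaban1983to89.B16StepFactorsPrinted

noncomputable section

/-- **p. 383 after (1.78), the rounding «we estimate the factors by exp(−p₀(g_j))» WITH THE LETTER `A₀`, PROVED** (render p029): in
the `ℓ = log g_j⁻²` dictionary — `R(g_j) = ℓ^{r₀}` ((2.5) [III]), `p₁(g_j) = ℓ^{p₁}` ([Balaban1989LargeFieldI] p. 183 l. 1),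
`p₀(g_j) = A₀ℓ^{p₀}` (`Setup.p0Profile`, supplied in rpow form as `hp0`) — the sharp preparatory exponent dominates the rounded one,
`exp(−R(g_j)^{−(d+5)}p₁(g_j)²) ≤ exp(−p₀(g_j))`, as soon as `A₀ ≤ ℓ^{2p₁ − (d+5)r₀ − p₀}` (`hlarge`): under the printed proviso
«2p₁ − (d + 5)r₀ > p₀» the exponent is positive, so `hlarge` is print's «g_j sufficiently small» made explicit (for `A₀ ≤ 1` it holds
from `ℓ ≥ 1`, `largeness_of_proviso_of_A₀_le_one`).  This is EXACTLY the hypothesis `hround` of `B16StepFactorsPrinted.stepFactor179_le`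
at `g := D.flow.g j`; the `A₀ = 1` case is the sibling's `B16Sect1Kernels.exp_lfFactor_le_exp_neg_p0`.  Real arithmetic; nothing of
Bałaban's asserted. [cite: Balaban1989LargeFieldII, p.383 (after (1.78))] -/
theorem hround_of_largeness {c : B16StepFactorsPrinted.Consts} {g ℓ p₁ r₀ : ℝ} (hℓ : 0 < ℓ) (hR : c.R g = ℓ ^ r₀)
    (hP1 : c.P1 g = ℓ ^ p₁) (hp0 : p0Profile c.A₀ c.p₀ g = c.A₀ * ℓ ^ (c.p₀ : ℝ))
    (hlarge : c.A₀ ≤ ℓ ^ (2 * p₁ - (c.d + 5) * r₀ - c.p₀)) :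
    Real.exp (-(c.R g ^ (c.d + 5))⁻¹ * c.P1 g ^ 2) ≤ Real.exp (-p0Profile c.A₀ c.p₀ g) := by
  rw [Real.exp_le_exp]
  have e1 : (c.R g ^ (c.d + 5))⁻¹ * c.P1 g ^ 2 = ℓ ^ (2 * p₁ - (c.d + 5) * r₀) := by
    rw [hR, hP1, ← Real.rpow_natCast (ℓ ^ r₀) (c.d + 5), ← Real.rpow_mul hℓ.le, ← Real.rpow_neg hℓ.le,
      ← Real.rpow_natCast (ℓ ^ p₁) 2, ← Real.rpow_mul hℓ.le, ← Real.rpow_add hℓ]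
    congr 1
    push_cast
    ring
  have key : p0Profile c.A₀ c.p₀ g ≤ (c.R g ^ (c.d + 5))⁻¹ * c.P1 g ^ 2 := by
    rw [e1, hp0]
    have hpow : 0 ≤ ℓ ^ (c.p₀ : ℝ) := Real.rpow_nonneg hℓ.le _
    calc c.A₀ * ℓ ^ (c.p₀ : ℝ) ≤ ℓ ^ (2 * p₁ - (c.d + 5) * r₀ - c.p₀) * ℓ ^ (c.p₀ : ℝ) :=
          mul_le_mul_of_nonneg_right hlarge hpow
      _ = ℓ ^ (2 * p₁ - (c.d + 5) * r₀) := by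
          rw [← Real.rpow_add hℓ]
          congr 1
          ring
  linarith

/-- The largeness `hlarge` from the printed proviso when `A₀ ≤ 1`: with «2p₁ − (d + 5)r₀ > p₀» (weakly) and `ℓ ≥ 1`,
`A₀ ≤ 1 ≤ ℓ^{2p₁ − (d+5)r₀ − p₀}` — the sibling's `A₀ = 1` normalisation as a special case. [cite: Balaban1989LargeFieldII, p.383 (after (1.78))] -/
theorem largeness_of_proviso_of_A₀_le_one {c : B16StepFactorsPrinted.Consts} {ℓ p₁ r₀ : ℝ} (hℓ : 1 ≤ ℓ) (hA₀ : c.A₀ ≤ 1)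
    (hprov : (c.p₀ : ℝ) ≤ 2 * p₁ - (c.d + 5) * r₀) : c.A₀ ≤ ℓ ^ (2 * p₁ - (c.d + 5) * r₀ - c.p₀) :=
  hA₀.trans (Real.one_le_rpow hℓ (by linarith))

/-- **THE SAME WITH (2.5)'s BRACKET FOR `R_j`** (lit-balaban r13's INFO on the idealisation `R_j = ℓ^{r₀}`): print's R_j is
«the smallest number of the form L^r such, that R_j ≧ (log g_j⁻²)^r» ([Balaban1988Convergent] (2.5); tree `B14.IsRj`), so
`ℓ^{r₀} ≤ R_j ≤ L·ℓ^{r₀}`; with the UPPER end `hR : c.R g ≤ Lf · ℓ^{r₀}` (`Lf` the blocking letter, `0 < c.R g`) the rounding holds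
under the largeness `c.A₀ · Lf^{d+5} ≤ ℓ^{2p₁ − (d+5)r₀ − p₀}` (one power `L^{d+5}` inside «g_j sufficiently small»).  Real arithmetic.
[cite: Balaban1989LargeFieldII, p.383 (after (1.78))] -/
theorem hround_of_largeness_bracket {c : B16StepFactorsPrinted.Consts} {g ℓ p₁ r₀ Lf : ℝ} (hℓ : 0 < ℓ) (hRpos : 0 < c.R g)
    (hR : c.R g ≤ Lf * ℓ ^ r₀) (hP1 : c.P1 g = ℓ ^ p₁) (hp0 : p0Profile c.A₀ c.p₀ g = c.A₀ * ℓ ^ (c.p₀ : ℝ))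
    (hlarge : c.A₀ * Lf ^ (c.d + 5) ≤ ℓ ^ (2 * p₁ - (c.d + 5) * r₀ - c.p₀)) :
    Real.exp (-(c.R g ^ (c.d + 5))⁻¹ * c.P1 g ^ 2) ≤ Real.exp (-p0Profile c.A₀ c.p₀ g) := by
  rw [Real.exp_le_exp]
  have hRpow : 0 < c.R g ^ (c.d + 5) := pow_pos hRpos _
  -- the idealised exponent at `R := Lf · ℓ^{r₀}`
  have e1 : ((Lf * ℓ ^ r₀) ^ (c.d + 5))⁻¹ * c.P1 g ^ 2 = (Lf ^ (c.d + 5))⁻¹ * ℓ ^ (2 * p₁ - (c.d + 5) * r₀) := by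
    rw [hP1, mul_pow, mul_inv, ← Real.rpow_natCast (ℓ ^ r₀) (c.d + 5), ← Real.rpow_mul hℓ.le, ← Real.rpow_neg hℓ.le,
      ← Real.rpow_natCast (ℓ ^ p₁) 2, ← Real.rpow_mul hℓ.le, mul_assoc, ← Real.rpow_add hℓ]
    congr 2
    push_cast
    ring
  -- monotonicity in `R` (a larger `R` only lowers the sharp exponent): `R ≤ Lf·ℓ^{r₀}`
  have hmono : ((Lf * ℓ ^ r₀) ^ (c.d + 5))⁻¹ * c.P1 g ^ 2 ≤ (c.R g ^ (c.d + 5))⁻¹ * c.P1 g ^ 2 := by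
    have hpow : c.R g ^ (c.d + 5) ≤ (Lf * ℓ ^ r₀) ^ (c.d + 5) := pow_le_pow_left₀ hRpos.le hR _
    exact mul_le_mul_of_nonneg_right ((inv_le_inv₀ (lt_of_lt_of_le hRpow hpow) hRpow).mpr hpow) (sq_nonneg _)
  have key : p0Profile c.A₀ c.p₀ g ≤ (Lf ^ (c.d + 5))⁻¹ * ℓ ^ (2 * p₁ - (c.d + 5) * r₀) := by
    rw [hp0]
    have hLf : 0 < Lf ^ (c.d + 5) := by
      have : 0 < Lf * ℓ ^ r₀ := lt_of_lt_of_le hRpos hR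
      have hLf0 : 0 < Lf := by
        by_contra hneg
        have : Lf * ℓ ^ r₀ ≤ 0 := mul_nonpos_of_nonpos_of_nonneg (not_lt.mp hneg) (Real.rpow_nonneg hℓ.le _)
        linarith
      exact pow_pos hLf0 _
    rw [le_inv_mul_iff₀ hLf]
    have hpow : 0 ≤ ℓ ^ (c.p₀ : ℝ) := Real.rpow_nonneg hℓ.le _
    calc Lf ^ (c.d + 5) * (c.A₀ * ℓ ^ (c.p₀ : ℝ)) = (c.A₀ * Lf ^ (c.d + 5)) * ℓ ^ (c.p₀ : ℝ) := by ring
      _ ≤ ℓ ^ (2 * p₁ - (c.d + 5) * r₀ - c.p₀) * ℓ ^ (c.p₀ : ℝ) := mul_le_mul_of_nonneg_right hlarge hpow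
      _ = ℓ ^ (2 * p₁ - (c.d + 5) * r₀) := by
          rw [← Real.rpow_add hℓ]
          congr 1
          ring
  linarith [key, hmono, e1.symm.le, e1.le]

/-- **`stepFactor179_le` WITH `hround` DISCHARGED**: the junction of IR-100-2 in the `ℓ_j = log g_j⁻²` dictionary at `g := D.flow.g j`
(`hR`, `hP1`, `hp0`) under the explicit largeness `hlarge` — every other hypothesis as in `B16StepFactorsPrinted.stepFactor179_le`.
[cite: Balaban1989LargeFieldII, p.383 («Let us summarize now the results of the above estimates»)] -/
theorem stepFactor179_le_of_largeness {D : B16.RunData} {j : ℕ} {X : StepCarriers D j} {c : B16StepFactorsPrinted.Consts}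
    (h : StepDisplaysAt D j X c) {cV : ℝ} (p : X.Choice)
    (hchain : c.C380 * Real.log ((D.flow.g (j + 1)) ^ 2)⁻¹ * X.volZ p ≤
      cV * c.M ^ c.d * c.R (D.flow.g (j + 1)) ^ (c.d + 1) * X.dZ p)
    (hB₃ : c.B₃ ≠ 0) (hγ : 0 ≤ c.γ₀)
    (hp : 0 ≤ p0Profile c.A₀ c.p₀ (D.flow.g (j + 1))) (hR2 : 2 * c.B₃ ^ 2 * c.A₁ ^ 2 ≤ c.A₀ ^ 2)
    (hsmall : 4 ≤ c.γ₀ * c.A₁ ^ 2 * p0Profile c.A₀ c.p₀ (D.flow.g (j + 1)))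
    {ℓ p₁ r₀ : ℝ} (hℓ : 0 < ℓ) (hR : c.R (D.flow.g j) = ℓ ^ r₀) (hP1 : c.P1 (D.flow.g j) = ℓ ^ p₁)
    (hp0 : p0Profile c.A₀ c.p₀ (D.flow.g j) = c.A₀ * ℓ ^ (c.p₀ : ℝ))
    (hlarge : c.A₀ ≤ ℓ ^ (2 * p₁ - (c.d + 5) * r₀ - c.p₀)) (v : X.V) :
    X.T1 p v ≤
      X.gInt p * X.aInt p * Real.exp (cV * c.M ^ c.d * c.R (D.flow.g (j + 1)) ^ (c.d + 1) * X.dZ p) *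
        ((∏ i ∈ X.comps p,
            Real.exp (-(1 / 2) * c.γ₀ * c.A₁ ^ 2 * p0Profile c.A₀ c.p₀ (D.flow.g (j + 1)) ^ 2 * (X.dC p i + 1) -
              2 * p0Profile c.A₀ c.p₀ (D.flow.g (j + 1)))) *
          ∏ _i ∈ X.primed p, Real.exp (-p0Profile c.A₀ c.p₀ (D.flow.g j))) :=
  stepFactor179_le h p hchain hB₃ hγ hp hR2 hsmall (hround_of_largeness hℓ hR hP1 hp0 hlarge) v

/-! ## §2 The volume side of (Y) in ONE exponential — the per-site letter `cΛ := C380 + C′` (the row owner's Q-J3-1 «which O(1)'s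
ride in cΛ», answered in kind: p. 380's vacuum∕normalisation O(1) and p. 383 l. 23's A_j-integral O(1), both per SITE of `Z`; the
history-count O(1) of p. 383 l. 24 stays on the counting side); supplier of J4's displayed `hvol` up to the cube count -/

/-- **THE VOLUME SIDE OF (Y) IN ONE EXPONENTIAL**: under the step's sentences, with `C′ ≥ 0`, `ℓ_{j+1} := log g_{j+1}⁻² ≥ 1`
(the run's couplings `≤ e^{−1∕2}` — inside `InInterval γ` for γ small) and `|Z ∩ Ω| ≤ |Z|` (`hΩ`, a carrier relation print takes for
granted: `Z_j ∩ Ω_j ⊆ Z_j`), the three volume-type factors of (Y) satisfy `gInt · aInt · vfac ≤ exp((C380 + C′) · ℓ_{j+1} · |Z|)`: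
(I)'s `gInt ≤ 1` (p. 383 l. 21 «estimated by 1»), (I)'s `aInt ≤ exp(C′|Z ∩ Ω|)` (p. 383 l. 23) and (V)'s `vfac ≤ exp(C380·ℓ·|Z|)`
(p. 380 l. 12–18) multiplied — the per-SITE volume letter `cΛ := C380 + C′` of the cell's END record (`HistReadDataLWL.hΛL`:
`log Λ = cΛ·(M·R_t)^d·ℓ_t` per MR_t-cube = `cΛ·ℓ_t` per site; owner Q-62-fit-1 «cΛ := O(1)_{p.380} + O(1)_{A_j}»).  Real arithmetic;
nothing of Bałaban's asserted. [cite: Balaban1989LargeFieldII, p.380 l.12-18 and p.383 l.21-24] -/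
theorem volumeSide_le_exp {D : B16.RunData} {j : ℕ} {X : StepCarriers D j} {c : B16StepFactorsPrinted.Consts}
    (h : StepDisplaysAt D j X c) (hC' : 0 ≤ c.C') (hℓ : 1 ≤ Real.log ((D.flow.g (j + 1)) ^ 2)⁻¹) (p : X.Choice)
    (hΩ : X.volZΩ p ≤ X.volZ p) :
    X.gInt p * X.aInt p * X.vfac p ≤ Real.exp ((c.C380 + c.C') * Real.log ((D.flow.g (j + 1)) ^ 2)⁻¹ * X.volZ p) := by
  obtain ⟨-, hV, -, -, hI⟩ := h
  obtain ⟨hvol0, hvf⟩ := hV p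
  obtain ⟨hg0, hg1, ha0, ha1⟩ := hI p
  set ℓ := Real.log ((D.flow.g (j + 1)) ^ 2)⁻¹ with hℓdef
  have ha : X.aInt p ≤ Real.exp (c.C' * ℓ * X.volZ p) := by
    refine ha1.trans (Real.exp_le_exp.mpr ?_)
    calc c.C' * X.volZΩ p ≤ c.C' * X.volZ p := mul_le_mul_of_nonneg_left hΩ hC'
      _ = c.C' * 1 * X.volZ p := by ring
      _ ≤ c.C' * ℓ * X.volZ p := mul_le_mul_of_nonneg_right (mul_le_mul_of_nonneg_left hℓ hC') hvol0
  have hGA : X.gInt p * X.aInt p ≤ Real.exp (c.C' * ℓ * X.volZ p) := by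
    calc X.gInt p * X.aInt p ≤ 1 * Real.exp (c.C' * ℓ * X.volZ p) := mul_le_mul hg1 ha ha0 zero_le_one
      _ = Real.exp (c.C' * ℓ * X.volZ p) := one_mul _
  have hGA0 : 0 ≤ X.gInt p * X.aInt p := mul_nonneg hg0 ha0
  calc X.gInt p * X.aInt p * X.vfac p ≤ X.gInt p * X.aInt p * Real.exp (c.C380 * ℓ * X.volZ p) :=
        mul_le_mul_of_nonneg_left hvf hGA0
    _ ≤ Real.exp (c.C' * ℓ * X.volZ p) * Real.exp (c.C380 * ℓ * X.volZ p) :=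
        mul_le_mul_of_nonneg_right hGA (Real.exp_pos _).le
    _ = Real.exp ((c.C380 + c.C') * ℓ * X.volZ p) := by
        rw [← Real.exp_add]
        congr 1
        ring

/-- **THE SAME IN THE LATTICE CURRENCY OF THE END RECORD**: if the created region's site volume is at most `(M·R)^d` times a cube
count `n` (`hZ` — print: `|Z_j|` counted in sites of the scale, an MR_j-cube has `(MR_j)^d` of them; the count is the consumer's,
J4's `hvol` ∕ (A1c)) and `C380 + C′ ≥ 0`, then `gInt · aInt · vfac ≤ exp((C380 + C′) · (M·R)^d · ℓ_{j+1} · n)` — i.e. `Λ^n` with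
`log Λ = cΛ·(M·R)^d·ℓ` per cube, the letter `uvolL` of `HistoryBankingVolumeWindowLattice` ∕ IR-100-1 (A) v2's `ΛexpL`.  Real arithmetic.
[cite: Balaban1989LargeFieldII, p.380 l.12-18 and p.383 l.21-24] -/
theorem volumeSide_le_exp_lattice {D : B16.RunData} {j : ℕ} {X : StepCarriers D j} {c : B16StepFactorsPrinted.Consts}
    (h : StepDisplaysAt D j X c) (hC' : 0 ≤ c.C') (hC : 0 ≤ c.C380 + c.C') (hℓ : 1 ≤ Real.log ((D.flow.g (j + 1)) ^ 2)⁻¹)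
    (p : X.Choice) (hΩ : X.volZΩ p ≤ X.volZ p) {M R n : ℝ} (hZ : X.volZ p ≤ (M * R) ^ c.d * n) :
    X.gInt p * X.aInt p * X.vfac p ≤ Real.exp ((c.C380 + c.C') * (M * R) ^ c.d * Real.log ((D.flow.g (j + 1)) ^ 2)⁻¹ * n) := by
  refine (volumeSide_le_exp h hC' hℓ p hΩ).trans (Real.exp_le_exp.mpr ?_)
  have hℓ0 : 0 ≤ Real.log ((D.flow.g (j + 1)) ^ 2)⁻¹ := zero_le_one.trans hℓ
  calc (c.C380 + c.C') * Real.log ((D.flow.g (j + 1)) ^ 2)⁻¹ * X.volZ p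
      ≤ (c.C380 + c.C') * Real.log ((D.flow.g (j + 1)) ^ 2)⁻¹ * ((M * R) ^ c.d * n) :=
        mul_le_mul_of_nonneg_left hZ (mul_nonneg hC hℓ0)
    _ = (c.C380 + c.C') * (M * R) ^ c.d * Real.log ((D.flow.g (j + 1)) ^ 2)⁻¹ * n := by ring

end

end Literature.MathematicalPhysics.QuantumFieldTheory.Balaban1983to89.B16StepFactorsRounding
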